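import Summits.HodgeConjecture.HodgeConjecture.Theorems.F0P3XiPacketFamilyOfRecordSCD    -- (A1ᴰ): the SCD record
import Summits.HodgeConjecture.HodgeConjecture.Theorems.F0P3XiPacketFamilyOfRecordGlue   -- ★ `hCM_of_cmCharIdentityPackage`, `hexc_of_xiPinSphericalCofinite`, `ramOfRecord₂`
import Literature.NumberTheory.Rogawski1990.CharIdentityOnTestFunctionsLemmas           -- ★ p840257 (A-p19): `CMNonsplitCharIdentityAtTest.πs_isSupercuspidal` ∕ `.πs_ne` (+ ★ p840183 `CMCharIdentityPackageTest`)
import Literature.NumberTheory.Automorphic.IrrClassEigencharacter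
import HarnessLib

/-!
# THE ξ-SIDE e.v.p. OF RECORD ON THE SUPERCUSPIDAL PARTNER DATUM (`…SCD` twins of ★ `F0P3XiEvpOfRecord` + ★ Glue §Exc) and the DATA bridges old ∕ package ∕ TEST package ⇒ SCD

Cell `hodgecm-mathlib`, F0∕P3 «U3-mult», crux H413 (`stmt-HodgeConjecture-24833`); LEAD F0P3a-plan (g9) T8-23 (A) «R4-SC» module A2ᴰ, desk F0P3-plan (g8) D20
branch (α), REF1 (g8) R-43 repair (F0P3a-p01 (g11), 2026-09-01).  DEF LANE: FOUR definitions (`hSCD_of_hCM`, `hSCD_of_cmCharIdentityPackage`,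
`hSCD_of_cmCharIdentityPackageTest` — DATA bridges — and `xiEvpOfRecordSCD`) + theorems; no instance, no notation, no named fact, no `sorry`.

§1 THE BRIDGES ARE DATA (the R-43 point): a supercuspidal partner datum is a subtype-valued FUNCTION, so the three bridges are `noncomputable def`s whose first
components are, DEFINITIONALLY, `(hCM …).πs` ∕ `(hQ.nonsplit …).πs` ∕ `((hQT ξ).1 …).πs` — certified by the `rfl` lemmas `…_fst` (REF1's pin certificate); hence at
the closer's kit (`hSC := hSCD_of_cmCharIdentityPackageTest … hQT`) the packet's second member is THE class of [13.1.4] on test functions and ★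
`CMNonsplitCharIdentityAtTest.charIdentityAtTest_πs` is that identity for it.  §2 = ★ Glue §Exc, §3 = ★ `F0P3XiEvpOfRecord` §1–§3, TOKEN FOR TOKEN with
the binder `hCM` replaced by the SUPERCUSPIDAL PARTNER **DATUM** (subtype-valued function — REF1 (g8) R-43 ∕ F0P2-p01 (g9) 03:31:31Z repair of
record of the Prop-valued `…SC` files ★ p840408∕p840437∕p840455, whose `Classical.choose` lost the (13.1.4) pin by proof irrelevance):
`hSC : ∀ ξ v hns T a ha h π2 πn, KeysCaseTwoLabels … π2 πn → ¬ πn.IsSquareIntegrable (μZ v) → {πs : IrrClass (U(H)(L⁺_v)) // πs.IsSupercuspidal ∧ πs ≠ πⁿ ∘ e}`;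
the record READS `(hSC …).1` — so when the closer instantiates `hSC := hSCD_of_cmCharIdentityPackageTest … hQT` (module `F0P3XiEvpOfRecordSCD`, a `noncomputable def`)
the packet's second member IS `((hQT ξ).1 …).πs` DEFINITIONALLY and ★ `CMNonsplitCharIdentityAtTest.charIdentityAtTest_πs` is [13.1.4] ON TEST FUNCTIONS for it.

References: [Rogawski1990] §12.2 (2) pp. 173–174, §13.1 Prop. 13.1.3 (d), Prop. 13.1.4 (p. 199), §13.3 p. 202, §13.7 pp. 206–208; [CartierCorvallis1979] §IV.1 Cor. 4.1.
HC_CM is proved only modulo the printed citations until rung 0 closes.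
-/

set_option autoImplicit false
set_option linter.dupNamespace false

noncomputable section

open NumberField IsDedekindDomain MeasureTheory Filter Topology
open scoped Matrix MatrixGroups

namespace Summit.HodgeConjecture.HodgeConjecture.Cruxes.H413.F0P3XiPacketFamilyOfRecordSCD

open Literature.NumberTheory Literature.NumberTheory.Automorphic Literature.NumberTheory.Automorphic.UnitaryGroup
open Literature.NumberTheory.Rogawski1990 Literature.NumberTheory.GaloisRepresentations
open F0P3XiLocalFamilyOfRecord F0P3XiPacketFamilyOfRecord

/-! ## §1 The bridges (DATA): old clause ⇒ SCD; package ⇒ SCD; TEST package ⇒ SCD, with the `rfl` pin certificates -/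

section BridgeOld

variable (L : Type) [Field L] [NumberField L] [IsCMField L] (H : Matrix (Fin 3) (Fin 3) L)
  (hH : (H.map (cmConjRingHom L))ᵀ = H) (hHd : IsUnit H.det) (μω : HeckeCharacter L) (hμu : μω.IsUnitary)
  -- the local data SHARED with T1's `ComparisonKit` ∕ F0P3b's `CMCharIdentityClauses` ((χ1), RULING (V28)); instance families as there (`borel` at 𝔠₀)
  [∀ v : HeightOneSpectrum (𝓞 ↥(maximalRealSubfield L)), MeasurableSpace ((cmDatum L 3 H).Local v)]
  [∀ v : HeightOneSpectrum (𝓞 ↥(maximalRealSubfield L)),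
    MeasurableSpace ((cmDatum L 2 (Matrix.of fun i j : Fin 2 => if i.val + j.val + 1 = 2 then (1 : L) else 0)).Local v ×
      (cmDatum L 1 (Matrix.of fun i j : Fin 1 => if i.val + j.val + 1 = 1 then (1 : L) else 0)).Local v)]
  [∀ (v : HeightOneSpectrum (𝓞 ↥(maximalRealSubfield L)))
      (a : ((cmDatum L 2 (Matrix.of fun i j : Fin 2 => if i.val + j.val + 1 = 2 then (1 : L) else 0)).Local v ×
        (cmDatum L 1 (Matrix.of fun i j : Fin 1 => if i.val + j.val + 1 = 1 then (1 : L) else 0)).Local v)),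
    MeasurableSpace (((cmDatum L 2 (Matrix.of fun i j : Fin 2 => if i.val + j.val + 1 = 2 then (1 : L) else 0)).Local v ×
        (cmDatum L 1 (Matrix.of fun i j : Fin 1 => if i.val + j.val + 1 = 1 then (1 : L) else 0)).Local v) ⧸
      Subgroup.centralizer ({a} : Set ((cmDatum L 2 (Matrix.of fun i j : Fin 2 => if i.val + j.val + 1 = 2 then (1 : L) else 0)).Local v ×
        (cmDatum L 1 (Matrix.of fun i j : Fin 1 => if i.val + j.val + 1 = 1 then (1 : L) else 0)).Local v)))]
  [∀ (v : HeightOneSpectrum (𝓞 ↥(maximalRealSubfield L))) (γ : (cmDatum L 3 H).Local v),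
    MeasurableSpace ((cmDatum L 3 H).Local v ⧸ Subgroup.centralizer ({γ} : Set ((cmDatum L 3 H).Local v)))]
  [∀ v : HeightOneSpectrum (𝓞 ↥(maximalRealSubfield L)), MeasurableSpace (Gqs L v ⧸ Subgroup.center (Gqs L v))]
  (Δ : ∀ v : HeightOneSpectrum (𝓞 ↥(maximalRealSubfield L)), LocalTransferFactor L H v)
  (mH : ∀ v : HeightOneSpectrum (𝓞 ↥(maximalRealSubfield L)),
    OrbitalMeasureFamily ((cmDatum L 2 (Matrix.of fun i j : Fin 2 => if i.val + j.val + 1 = 2 then (1 : L) else 0)).Local v ×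
      (cmDatum L 1 (Matrix.of fun i j : Fin 1 => if i.val + j.val + 1 = 1 then (1 : L) else 0)).Local v))
  (mG : ∀ v : HeightOneSpectrum (𝓞 ↥(maximalRealSubfield L)), OrbitalMeasureFamily ((cmDatum L 3 H).Local v))
  (νG : ∀ v : HeightOneSpectrum (𝓞 ↥(maximalRealSubfield L)), Measure ((cmDatum L 3 H).Local v))
  (νH : ∀ v : HeightOneSpectrum (𝓞 ↥(maximalRealSubfield L)),
    Measure ((cmDatum L 2 (Matrix.of fun i j : Fin 2 => if i.val + j.val + 1 = 2 then (1 : L) else 0)).Local v ×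
      (cmDatum L 1 (Matrix.of fun i j : Fin 1 => if i.val + j.val + 1 = 1 then (1 : L) else 0)).Local v))
  (ξloc : OneDimAutRepH L → ∀ v : HeightOneSpectrum (𝓞 ↥(maximalRealSubfield L)),
    (cmDatum L 2 (Matrix.of fun i j : Fin 2 => if i.val + j.val + 1 = 2 then (1 : L) else 0)).Local v ×
      (cmDatum L 1 (Matrix.of fun i j : Fin 1 => if i.val + j.val + 1 = 1 then (1 : L) else 0)).Local v →* ℂˣ)
  (μZ : ∀ v : HeightOneSpectrum (𝓞 ↥(maximalRealSubfield L)), Measure (Gqs L v ⧸ Subgroup.center (Gqs L v)))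

/-- **`hSCD_of_hCM` — the ★ ED. 2 clause yields the supercuspidal partner DATUM** (edge old ⇒ new: `πˢ := (hCM …).πs` = the class READ OFF the bare-function identity,
with `πs_isSupercuspidal`, `πs_ne`).  A `noncomputable def` (data). [cite: Rogawski1990, §13.1 Prop. 13.1.3 (d), Prop. 13.1.4 p. 199] -/
def hSCD_of_hCM
    (hCM : ∀ (ξ : OneDimAutRepH L) (v : HeightOneSpectrum (𝓞 ↥(maximalRealSubfield L)))
      (hns : ∀ w : PlacesOver L v, IsCMField.complexConj L • w.1 = w.1)
      (T : GL (Fin 3) (LocalRing L v)) (a : LocalRing L v) (ha : IsUnit a)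
      (h : formCongr (conjLocal L (IsCMField.complexConj L) v) T (H.map (algebraMap L (LocalRing L v))) =
        a • (Matrix.of fun i j : Fin 3 => if i.val + j.val + 1 = 3 then (1 : L) else 0).map (algebraMap L (LocalRing L v)))
      (π2 πn : IrrClass (Gqs L v)),
      KeysCaseTwoLabels L v (μω.semilocalComponent L v) (torusLocalComponent L (IsCMField.complexConj L) v ξ.η)
        (torusLocalComponent L (IsCMField.complexConj L) v ξ.ψ) π2 πn → ¬ πn.IsSquareIntegrable (μZ v) →
      CMNonsplitCharIdentityAt L v H (Δ v) (mH v) (mG v) (νG v) (νH v) (ξloc ξ v) (IrrClass.comap (cmDatumLocalCongr L v T ha h).symm πn)) :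
    ∀ (ξ : OneDimAutRepH L) (v : HeightOneSpectrum (𝓞 ↥(maximalRealSubfield L)))
      (hns : ∀ w : PlacesOver L v, IsCMField.complexConj L • w.1 = w.1)
      (T : GL (Fin 3) (LocalRing L v)) (a : LocalRing L v) (ha : IsUnit a)
      (h : formCongr (conjLocal L (IsCMField.complexConj L) v) T (H.map (algebraMap L (LocalRing L v))) =
        a • (Matrix.of fun i j : Fin 3 => if i.val + j.val + 1 = 3 then (1 : L) else 0).map (algebraMap L (LocalRing L v)))
      (π2 πn : IrrClass (Gqs L v)),
      KeysCaseTwoLabels L v (μω.semilocalComponent L v) (torusLocalComponent L (IsCMField.complexConj L) v ξ.η)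
        (torusLocalComponent L (IsCMField.complexConj L) v ξ.ψ) π2 πn → ¬ πn.IsSquareIntegrable (μZ v) →
      {πs : IrrClass ((cmDatum L 3 H).Local v) // πs.IsSupercuspidal ∧ πs ≠ IrrClass.comap (cmDatumLocalCongr L v T ha h).symm πn} :=
  fun ξ v hns T a ha h π2 πn hk hn =>
    ⟨(hCM ξ v hns T a ha h π2 πn hk hn).πs, (hCM ξ v hns T a ha h π2 πn hk hn).πs_isSupercuspidal, (hCM ξ v hns T a ha h π2 πn hk hn).πs_ne⟩

end BridgeOld

section BridgePackage

variable (L : Type) [Field L] [NumberField L] [IsCMField L] (H : Matrix (Fin 3) (Fin 3) L)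
  (hH : (H.map (cmConjRingHom L))ᵀ = H) (hHd : IsUnit H.det) (μω : HeckeCharacter L) (hμu : μω.IsUnitary)
  -- the local data SHARED with T1's `ComparisonKit` ∕ F0P3b's `CMCharIdentityClauses` ((χ1), RULING (V28)); instance families as there (`borel` at 𝔠₀)
  [∀ v : HeightOneSpectrum (𝓞 ↥(maximalRealSubfield L)), MeasurableSpace ((cmDatum L 3 H).Local v)]
  [∀ v : HeightOneSpectrum (𝓞 ↥(maximalRealSubfield L)),
    MeasurableSpace ((cmDatum L 2 (Matrix.of fun i j : Fin 2 => if i.val + j.val + 1 = 2 then (1 : L) else 0)).Local v ×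
      (cmDatum L 1 (Matrix.of fun i j : Fin 1 => if i.val + j.val + 1 = 1 then (1 : L) else 0)).Local v)]
  [∀ (v : HeightOneSpectrum (𝓞 ↥(maximalRealSubfield L)))
      (a : ((cmDatum L 2 (Matrix.of fun i j : Fin 2 => if i.val + j.val + 1 = 2 then (1 : L) else 0)).Local v ×
        (cmDatum L 1 (Matrix.of fun i j : Fin 1 => if i.val + j.val + 1 = 1 then (1 : L) else 0)).Local v)),
    MeasurableSpace (((cmDatum L 2 (Matrix.of fun i j : Fin 2 => if i.val + j.val + 1 = 2 then (1 : L) else 0)).Local v ×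
        (cmDatum L 1 (Matrix.of fun i j : Fin 1 => if i.val + j.val + 1 = 1 then (1 : L) else 0)).Local v) ⧸
      Subgroup.centralizer ({a} : Set ((cmDatum L 2 (Matrix.of fun i j : Fin 2 => if i.val + j.val + 1 = 2 then (1 : L) else 0)).Local v ×
        (cmDatum L 1 (Matrix.of fun i j : Fin 1 => if i.val + j.val + 1 = 1 then (1 : L) else 0)).Local v)))]
  [∀ (v : HeightOneSpectrum (𝓞 ↥(maximalRealSubfield L))) (γ : (cmDatum L 3 H).Local v),
    MeasurableSpace ((cmDatum L 3 H).Local v ⧸ Subgroup.centralizer ({γ} : Set ((cmDatum L 3 H).Local v)))]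
  [∀ v : HeightOneSpectrum (𝓞 ↥(maximalRealSubfield L)), MeasurableSpace (Gqs L v ⧸ Subgroup.center (Gqs L v))]
  (Δ : ∀ v : HeightOneSpectrum (𝓞 ↥(maximalRealSubfield L)), LocalTransferFactor L H v)
  (mH : ∀ v : HeightOneSpectrum (𝓞 ↥(maximalRealSubfield L)),
    OrbitalMeasureFamily ((cmDatum L 2 (Matrix.of fun i j : Fin 2 => if i.val + j.val + 1 = 2 then (1 : L) else 0)).Local v ×
      (cmDatum L 1 (Matrix.of fun i j : Fin 1 => if i.val + j.val + 1 = 1 then (1 : L) else 0)).Local v))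
  (mG : ∀ v : HeightOneSpectrum (𝓞 ↥(maximalRealSubfield L)), OrbitalMeasureFamily ((cmDatum L 3 H).Local v))
  (νG : ∀ v : HeightOneSpectrum (𝓞 ↥(maximalRealSubfield L)), Measure ((cmDatum L 3 H).Local v))
  (νH : ∀ v : HeightOneSpectrum (𝓞 ↥(maximalRealSubfield L)),
    Measure ((cmDatum L 2 (Matrix.of fun i j : Fin 2 => if i.val + j.val + 1 = 2 then (1 : L) else 0)).Local v ×
      (cmDatum L 1 (Matrix.of fun i j : Fin 1 => if i.val + j.val + 1 = 1 then (1 : L) else 0)).Local v))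
  (ξloc : OneDimAutRepH L → ∀ v : HeightOneSpectrum (𝓞 ↥(maximalRealSubfield L)),
    (cmDatum L 2 (Matrix.of fun i j : Fin 2 => if i.val + j.val + 1 = 2 then (1 : L) else 0)).Local v ×
      (cmDatum L 1 (Matrix.of fun i j : Fin 1 => if i.val + j.val + 1 = 1 then (1 : L) else 0)).Local v →* ℂˣ)
  (μZ : ∀ v : HeightOneSpectrum (𝓞 ↥(maximalRealSubfield L)), Measure (Gqs L v ⧸ Subgroup.center (Gqs L v)))
  [∀ v : HeightOneSpectrum (𝓞 ↥(maximalRealSubfield L)), BorelSpace (Gqs L v ⧸ Subgroup.center (Gqs L v))]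
  [∀ v : HeightOneSpectrum (𝓞 ↥(maximalRealSubfield L)), (μZ v).IsHaarMeasure]

/-- **`hSCD₀` FROM THE PACKAGE** ★ `CMCharIdentityPackage … Δ mH mG` (today's closer binder `hQ`): the supercuspidal partner DATUM at the local characters `ξ.xiLocalChar v`
and the record's Haar family `μZ`, `πˢ := (hQ.nonsplit …).πs` (★ `CMCharIdentityPackage.nonsplit`).  A `noncomputable def`. [cite: Rogawski1990, §13.1 Prop. 13.1.4 p. 199; §13.3 p. 202] -/
def hSCD_of_cmCharIdentityPackage (hQ : CMCharIdentityPackage L H hH hHd νH νG μω hμu Δ mH mG) :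
    ∀ (ξ : OneDimAutRepH L) (v : HeightOneSpectrum (𝓞 ↥(maximalRealSubfield L)))
      (hns : ∀ w : PlacesOver L v, IsCMField.complexConj L • w.1 = w.1)
      (T : GL (Fin 3) (LocalRing L v)) (a : LocalRing L v) (ha : IsUnit a)
      (h : formCongr (conjLocal L (IsCMField.complexConj L) v) T (H.map (algebraMap L (LocalRing L v))) =
        a • (Matrix.of fun i j : Fin 3 => if i.val + j.val + 1 = 3 then (1 : L) else 0).map (algebraMap L (LocalRing L v)))
      (π2 πn : IrrClass (Gqs L v)),
      KeysCaseTwoLabels L v (μω.semilocalComponent L v) (torusLocalComponent L (IsCMField.complexConj L) v ξ.η)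
        (torusLocalComponent L (IsCMField.complexConj L) v ξ.ψ) π2 πn → ¬ πn.IsSquareIntegrable (μZ v) →
      {πs : IrrClass ((cmDatum L 3 H).Local v) // πs.IsSupercuspidal ∧ πs ≠ IrrClass.comap (cmDatumLocalCongr L v T ha h).symm πn} :=
  fun ξ v hns T a ha h π2 πn hk hn =>
    ⟨(hQ.nonsplit ξ v hns T a ha h (μZ v) π2 πn hk hn).πs, (hQ.nonsplit ξ v hns T a ha h (μZ v) π2 πn hk hn).πs_isSupercuspidal,
      (hQ.nonsplit ξ v hns T a ha h (μZ v) π2 πn hk hn).πs_ne⟩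

/-- **`hSCD₀` FROM THE TEST PACKAGE** ★ `CMCharIdentityPackageTest … Δ mH mG` (A-p19 (g21) p840183∕p840257, the `C_c^∞` repair of Q-CM; the closer's re-typed binder `hQT`
under desk D20 branch (α)): the supercuspidal partner DATUM `πˢ := ((hQT ξ).1 v …).πs` READ OFF [13.1.4] ON TEST FUNCTIONS (★ `CMNonsplitCharIdentityAtTest.πs` ∕ `.πs_isSupercuspidal` ∕
`.πs_ne`).  A `noncomputable def`. [cite: Rogawski1990, §13.1 Prop. 13.1.3 (d), Prop. 13.1.4 p. 199; §13.3 p. 202] -/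
def hSCD_of_cmCharIdentityPackageTest (hQT : CMCharIdentityPackageTest L H hH hHd νH νG μω hμu Δ mH mG) :
    ∀ (ξ : OneDimAutRepH L) (v : HeightOneSpectrum (𝓞 ↥(maximalRealSubfield L)))
      (hns : ∀ w : PlacesOver L v, IsCMField.complexConj L • w.1 = w.1)
      (T : GL (Fin 3) (LocalRing L v)) (a : LocalRing L v) (ha : IsUnit a)
      (h : formCongr (conjLocal L (IsCMField.complexConj L) v) T (H.map (algebraMap L (LocalRing L v))) =
        a • (Matrix.of fun i j : Fin 3 => if i.val + j.val + 1 = 3 then (1 : L) else 0).map (algebraMap L (LocalRing L v)))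
      (π2 πn : IrrClass (Gqs L v)),
      KeysCaseTwoLabels L v (μω.semilocalComponent L v) (torusLocalComponent L (IsCMField.complexConj L) v ξ.η)
        (torusLocalComponent L (IsCMField.complexConj L) v ξ.ψ) π2 πn → ¬ πn.IsSquareIntegrable (μZ v) →
      {πs : IrrClass ((cmDatum L 3 H).Local v) // πs.IsSupercuspidal ∧ πs ≠ IrrClass.comap (cmDatumLocalCongr L v T ha h).symm πn} :=
  fun ξ v hns T a ha h π2 πn hk hn =>
    ⟨((hQT ξ).1 v hns T a ha h (μZ v) π2 πn hk hn).πs, ((hQT ξ).1 v hns T a ha h (μZ v) π2 πn hk hn).πs_isSupercuspidal,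
      ((hQT ξ).1 v hns T a ha h (μZ v) π2 πn hk hn).πs_ne⟩

/-- **PIN CERTIFICATE (REF1 (g8) R-43)**: the datum's class IS the Test package's `πˢ`, definitionally — so ★ `CMNonsplitCharIdentityAtTest.charIdentityAtTest_πs` is [13.1.4]
on test functions FOR THE RECORD'S SECOND MEMBER. [cite: Rogawski1990, §13.1 Prop. 13.1.4 p. 199] -/
theorem hSCD_of_cmCharIdentityPackageTest_fst (hQT : CMCharIdentityPackageTest L H hH hHd νH νG μω hμu Δ mH mG)
    (ξ : OneDimAutRepH L) (v : HeightOneSpectrum (𝓞 ↥(maximalRealSubfield L))) (hns : ∀ w : PlacesOver L v, IsCMField.complexConj L • w.1 = w.1)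
    (T : GL (Fin 3) (LocalRing L v)) (a : LocalRing L v) (ha : IsUnit a)
    (h : formCongr (conjLocal L (IsCMField.complexConj L) v) T (H.map (algebraMap L (LocalRing L v))) =
      a • (Matrix.of fun i j : Fin 3 => if i.val + j.val + 1 = 3 then (1 : L) else 0).map (algebraMap L (LocalRing L v)))
    (π2 πn : IrrClass (Gqs L v))
    (hk : KeysCaseTwoLabels L v (μω.semilocalComponent L v) (torusLocalComponent L (IsCMField.complexConj L) v ξ.η)
      (torusLocalComponent L (IsCMField.complexConj L) v ξ.ψ) π2 πn) (hn : ¬ πn.IsSquareIntegrable (μZ v)) :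
    (hSCD_of_cmCharIdentityPackageTest L H hH hHd μω hμu Δ mH mG νG νH μZ hQT ξ v hns T a ha h π2 πn hk hn).1 =
      ((hQT ξ).1 v hns T a ha h (μZ v) π2 πn hk hn).πs :=
  rfl

end BridgePackage

/-! ## §2 Law `XiUnram` from the letters of record, SCD record (★ Glue §Exc with `hCM ↦ hSC`) -/

section Exc

variable (L : Type) [Field L] [NumberField L] [IsCMField L] (H : Matrix (Fin 3) (Fin 3) L)
  (hH : (H.map (cmConjRingHom L))ᵀ = H) (hHd : IsUnit H.det) (μω : HeckeCharacter L) (hμu : μω.IsUnitary)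
  -- the local data SHARED with T1's `ComparisonKit` ∕ F0P3b's `CMCharIdentityClauses` ((χ1), RULING (V28)); instance families as there (`borel` at 𝔠₀)
  [∀ v : HeightOneSpectrum (𝓞 ↥(maximalRealSubfield L)), MeasurableSpace ((cmDatum L 3 H).Local v)]
  [∀ v : HeightOneSpectrum (𝓞 ↥(maximalRealSubfield L)), MeasurableSpace (Gqs L v ⧸ Subgroup.center (Gqs L v))]
  (μZ : ∀ v : HeightOneSpectrum (𝓞 ↥(maximalRealSubfield L)), Measure (Gqs L v ⧸ Subgroup.center (Gqs L v)))
  [∀ v : HeightOneSpectrum (𝓞 ↥(maximalRealSubfield L)), BorelSpace (Gqs L v ⧸ Subgroup.center (Gqs L v))]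
  [∀ v : HeightOneSpectrum (𝓞 ↥(maximalRealSubfield L)), (μZ v).IsHaarMeasure]
  (keys : ∀ (ξ : OneDimAutRepH L) (v : HeightOneSpectrum (𝓞 ↥(maximalRealSubfield L))),
    (∀ w : PlacesOver L v, IsCMField.complexConj L • w.1 = w.1) →
      {p : IrrClass (Gqs L v) × IrrClass (Gqs L v) //
        KeysCaseTwoLabels L v (μω.semilocalComponent L v) (torusLocalComponent L (IsCMField.complexConj L) v ξ.η)
          (torusLocalComponent L (IsCMField.complexConj L) v ξ.ψ) p.1 p.2 ∧
        p.1.IsSquareIntegrable (μZ v) ∧ ¬ p.2.IsSquareIntegrable (μZ v)})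
  (hSC : ∀ (ξ : OneDimAutRepH L) (v : HeightOneSpectrum (𝓞 ↥(maximalRealSubfield L)))
    (hns : ∀ w : PlacesOver L v, IsCMField.complexConj L • w.1 = w.1)
    (T : GL (Fin 3) (LocalRing L v)) (a : LocalRing L v) (ha : IsUnit a)
    (h : formCongr (conjLocal L (IsCMField.complexConj L) v) T (H.map (algebraMap L (LocalRing L v))) =
      a • (Matrix.of fun i j : Fin 3 => if i.val + j.val + 1 = 3 then (1 : L) else 0).map (algebraMap L (LocalRing L v)))
    (π2 πn : IrrClass (Gqs L v)),
    KeysCaseTwoLabels L v (μω.semilocalComponent L v) (torusLocalComponent L (IsCMField.complexConj L) v ξ.η)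
      (torusLocalComponent L (IsCMField.complexConj L) v ξ.ψ) π2 πn → ¬ πn.IsSquareIntegrable (μZ v) →
    {πs : IrrClass ((cmDatum L 3 H).Local v) // πs.IsSupercuspidal ∧ πs ≠ IrrClass.comap (cmDatumLocalCongr L v T ha h).symm πn})
  (hquad : ∀ v : HeightOneSpectrum (𝓞 ↥(maximalRealSubfield L)), (∀ w : PlacesOver L v, IsCMField.complexConj L • w.1 = w.1) →
    IsQuadraticCharExtension (conjLocal L (IsCMField.complexConj L) v) (μω.semilocalComponent L v))


/-- **LAW `XiUnram` AT 𝔠₀ FROM THE LETTERS OF RECORD**: with `ram₀ ξ := ramOfRecord₂ … ξ (hexc_of_xiPinSphericalCofinite …)`, for `v ∉ ram₀ ξ` and any Haar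
measure on `G′_v` the record's Keys member is `K_v`-spherical WITH its eigencharacter and admissible (★ `xiUnram_xiPacketFamilyOfRecordSCD`).
[cite: Rogawski1990, §12.2 pp. 173–174; §13.1 p. 199; §13.7 p. 208] [cite: CartierCorvallis1979, §IV.1 Cor. 4.1] -/
theorem xiUnram_of_xiPinSphericalCofiniteSCD (hLi : XiPinSphericalCofinite L) (ξ : OneDimAutRepH L)
    (v : HeightOneSpectrum (𝓞 ↥(maximalRealSubfield L)))
    (hv : v ∉ ramOfRecord₂ L H hH hHd μω μZ keys ξ
      (hexc_of_xiPinSphericalCofinite L μω hμu μZ keys hquad hLi ξ))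
    [BorelSpace ((cmDatum L 3 H).Local v)] (μ : Measure ((cmDatum L 3 H).Local v)) [μ.IsHaarMeasure] :
    (xiPacketFamilyOfRecordSCD L H hH hHd μω hμu μZ keys hSC ξ v).πn.IsSphericalWith (cmLocalIntegralLevel L 3 H v) μ
        (fun f => (μ.real (cmLocalIntegralLevel L 3 H v : Set ((cmDatum L 3 H).Local v)) : ℂ)⁻¹ *
          (xiPacketFamilyOfRecordSCD L H hH hHd μω hμu μZ keys hSC ξ v).πn.smoothTrace μ f) ∧
      (xiPacketFamilyOfRecordSCD L H hH hHd μω hμu μZ keys hSC ξ v).πn.IsAdmissible :=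
  xiUnram_xiPacketFamilyOfRecordSCD L H hH hHd μω hμu μZ keys hSC ξ v hv μ


end Exc

/-! ## §3 `tXi₀` on the SCD record (★ `F0P3XiEvpOfRecord` with `hCM ↦ hSC`) -/

section Evp

variable (L : Type) [Field L] [NumberField L] [IsCMField L] (H : Matrix (Fin 3) (Fin 3) L)
  (hH : (H.map (cmConjRingHom L))ᵀ = H) (hHd : IsUnit H.det) (μω : HeckeCharacter L) (hμu : μω.IsUnitary)
  -- the local data SHARED with T1's `ComparisonKit` ∕ F0P3b's `CMCharIdentityClauses` ((χ1), RULING (V28)); instance families as there (`borel` at 𝔠₀)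
  [∀ v : HeightOneSpectrum (𝓞 ↥(maximalRealSubfield L)), MeasurableSpace ((cmDatum L 3 H).Local v)]
  [∀ v : HeightOneSpectrum (𝓞 ↥(maximalRealSubfield L)), MeasurableSpace (Gqs L v ⧸ Subgroup.center (Gqs L v))]
  (μZ : ∀ v : HeightOneSpectrum (𝓞 ↥(maximalRealSubfield L)), Measure (Gqs L v ⧸ Subgroup.center (Gqs L v)))
  (keys : ∀ (ξ : OneDimAutRepH L) (v : HeightOneSpectrum (𝓞 ↥(maximalRealSubfield L))),
    (∀ w : PlacesOver L v, IsCMField.complexConj L • w.1 = w.1) →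
      {p : IrrClass (Gqs L v) × IrrClass (Gqs L v) //
        KeysCaseTwoLabels L v (μω.semilocalComponent L v) (torusLocalComponent L (IsCMField.complexConj L) v ξ.η)
          (torusLocalComponent L (IsCMField.complexConj L) v ξ.ψ) p.1 p.2 ∧
        p.1.IsSquareIntegrable (μZ v) ∧ ¬ p.2.IsSquareIntegrable (μZ v)})
  (hSC : ∀ (ξ : OneDimAutRepH L) (v : HeightOneSpectrum (𝓞 ↥(maximalRealSubfield L)))
    (hns : ∀ w : PlacesOver L v, IsCMField.complexConj L • w.1 = w.1)
    (T : GL (Fin 3) (LocalRing L v)) (a : LocalRing L v) (ha : IsUnit a)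
    (h : formCongr (conjLocal L (IsCMField.complexConj L) v) T (H.map (algebraMap L (LocalRing L v))) =
      a • (Matrix.of fun i j : Fin 3 => if i.val + j.val + 1 = 3 then (1 : L) else 0).map (algebraMap L (LocalRing L v)))
    (π2 πn : IrrClass (Gqs L v)),
    KeysCaseTwoLabels L v (μω.semilocalComponent L v) (torusLocalComponent L (IsCMField.complexConj L) v ξ.η)
      (torusLocalComponent L (IsCMField.complexConj L) v ξ.ψ) π2 πn → ¬ πn.IsSquareIntegrable (μZ v) →
    {πs : IrrClass ((cmDatum L 3 H).Local v) // πs.IsSupercuspidal ∧ πs ≠ IrrClass.comap (cmDatumLocalCongr L v T ha h).symm πn})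
  (hquad : ∀ v : HeightOneSpectrum (𝓞 ↥(maximalRealSubfield L)), (∀ w : PlacesOver L v, IsCMField.complexConj L • w.1 = w.1) →
    IsQuadraticCharExtension (conjLocal L (IsCMField.complexConj L) v) (μω.semilocalComponent L v))



/-! ## §1 `tXi₀`: the ξ-side e.v.p. of record, eigencharacter currency -/

/-- **`tXi₀ ξ` — THE ξ-SIDE e.v.p. OF RECORD** (T5 kit field `tXi` at 𝔠₀): at the finite place `v`, the NORMALISED EIGENCHARACTER at level `K_v = U(H)(𝒪_v)` for the
measure `μv v` of the unramified-type member `πⁿ` of the packet of record (★ `xiPacketFamilyOfRecordSCD`, ED. 2 (I′)) — `f ↦ μ_v(K_v)⁻¹ · tr πⁿ(f)` on `C_c(K_v\G′_v/K_v)`,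
`0` elsewhere (★ `IrrClass.eigencharacter`, the junk convention of law `EvpConvention`).  Off `ram₀ ξ` this IS the e.v.p. `t(ξ_v)` of `πⁿ(ξ_v)` [Rogawski1990 §12.2
p. 174 l. 1; §13.7 p. 206]. [cite: Rogawski1990, §12.2 pp. 173–174; §13.7 p. 206] [cite: CartierCorvallis1979, §IV.1 Cor. 4.1] -/
def xiEvpOfRecordSCD (μv : ∀ v : HeightOneSpectrum (𝓞 ↥(maximalRealSubfield L)), Measure ((cmDatum L 3 H).Local v)) (ξ : OneDimAutRepH L) :
    ∀ v : HeightOneSpectrum (𝓞 ↥(maximalRealSubfield L)), (((cmDatum L 3 H).Local v) → ℂ) → ℂ :=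
  fun v => (xiPacketFamilyOfRecordSCD L H hH hHd μω hμu μZ keys hSC ξ v).πn.eigencharacter (cmLocalIntegralLevel L 3 H v) (μv v)

/-- Unfolding `xiEvpOfRecordSCD`. [cite: CartierCorvallis1979, §IV.1] -/
theorem xiEvpOfRecordSCD_apply (μv : ∀ v : HeightOneSpectrum (𝓞 ↥(maximalRealSubfield L)), Measure ((cmDatum L 3 H).Local v)) (ξ : OneDimAutRepH L)
    (v : HeightOneSpectrum (𝓞 ↥(maximalRealSubfield L))) :
    xiEvpOfRecordSCD L H hH hHd μω hμu μZ keys hSC μv ξ v = (xiPacketFamilyOfRecordSCD L H hH hHd μω hμu μZ keys hSC ξ v).πn.eigencharacter (cmLocalIntegralLevel L 3 H v) (μv v) :=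
  rfl

/-- **LAW `EvpConvention`, CLAUSE (ξ), AT 𝔠₀**: off `C_c(K_v\G′_v/K_v)` the ξ-side e.v.p. of record is `0` (★ `IrrClass.eigencharacter_of_not`).
[cite: CartierCorvallis1979, §IV.1] [cite: Rogawski1990, §13.7 p. 206] -/
theorem xiEvpOfRecordSCD_of_not (μv : ∀ v : HeightOneSpectrum (𝓞 ↥(maximalRealSubfield L)), Measure ((cmDatum L 3 H).Local v)) (ξ : OneDimAutRepH L)
    (v : HeightOneSpectrum (𝓞 ↥(maximalRealSubfield L))) (f : (cmDatum L 3 H).Local v → ℂ)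
    (hf : ¬ (HasCompactSupport f ∧ IsLevel (cmLocalIntegralLevel L 3 H v) f)) : xiEvpOfRecordSCD L H hH hHd μω hμu μZ keys hSC μv ξ v f = 0 :=
  IrrClass.eigencharacter_of_not _ _ _ hf

/-- The `EvpConvention` (ξ) clause as the T5 line quantifies it (all `ξ v f` at once). [cite: CartierCorvallis1979, §IV.1] -/
theorem evpConvention_xi_xiEvpOfRecordSCD (μv : ∀ v : HeightOneSpectrum (𝓞 ↥(maximalRealSubfield L)), Measure ((cmDatum L 3 H).Local v)) :
    ∀ (ξ : OneDimAutRepH L) (v : HeightOneSpectrum (𝓞 ↥(maximalRealSubfield L))) (f : (cmDatum L 3 H).Local v → ℂ),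
      ¬ (HasCompactSupport f ∧ IsLevel (cmLocalIntegralLevel L 3 H v) f) → xiEvpOfRecordSCD L H hH hHd μω hμu μZ keys hSC μv ξ v f = 0 :=
  fun ξ v f hf => xiEvpOfRecordSCD_of_not L H hH hHd μω hμu μZ keys hSC μv ξ v f hf

/-! ## §2 Law `XiUnram` at `tXi₀` -/

/-- **LAW `XiUnram` AT 𝔠₀ IN EIGENCHARACTER CURRENCY, «good place» form**: at a place `v` good for the record (all of `η̃, ψ̃, μ` unramified over `v`, `H`
`𝒪_v`-unimodular, and — if `v` is non-split — a level-matching congruence exists and the Keys member is `K_v`-spherical), for a Haar measure `μv v` on `G′_v`, the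
member `πⁿ` of record is `K_v`-spherical WITH `tXi₀ ξ v` and admissible (★ `isAdmissible_isSpherical_πn_of_goodSCD` + ★ `IsSpherical.isSphericalWith_eigencharacter`,
`K_v` compact open ★ `isCompact_isOpen_cmLocalIntegralLevel`, `μ_v(K_v) ≠ 0` ★ `measureReal_cmLocalIntegralLevel_ne_zero`).
[cite: Rogawski1990, §12.2 pp. 173–174; §13.1 p. 199; §13.7 p. 206] [cite: CartierCorvallis1979, §IV.1 Cor. 4.1] -/
theorem xiUnram_xiEvpOfRecordSCD_of_good (μv : ∀ v : HeightOneSpectrum (𝓞 ↥(maximalRealSubfield L)), Measure ((cmDatum L 3 H).Local v))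
    (ξ : OneDimAutRepH L) (v : HeightOneSpectrum (𝓞 ↥(maximalRealSubfield L))) [BorelSpace ((cmDatum L 3 H).Local v)] [(μv v).IsHaarMeasure]
    (hgood : (∀ w : PlacesOver L v, ξ.bcη.IsUnramifiedAt w.1 ∧ ξ.bcψ.IsUnramifiedAt w.1 ∧ μω.IsUnramifiedAt w.1 ∧
          (isUnit_placeForm_of_isUnit_det hHd w.1).unit ∈ glInt 3 (w.1.adicCompletion L)) ∧
        (∀ hns : ∀ w : PlacesOver L v, IsCMField.complexConj L • w.1 = w.1,
          (∃ (T' : GL (Fin 3) (LocalRing L v)) (a' : LocalRing L v) (ha' : IsUnit a')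
          (h' : formCongr (conjLocal L (IsCMField.complexConj L) v) T' (H.map (algebraMap L (LocalRing L v))) =
            a' • (Matrix.of fun i j : Fin 3 => if i.val + j.val + 1 = 3 then (1 : L) else 0).map (algebraMap L (LocalRing L v))),
          ∀ g : (cmDatum L 3 H).Local v, (cmDatumLocalCongr L v T' ha' h').symm g ∈ cmLocalIntegralLevel L 3 (qsForm L) v ↔
            g ∈ cmLocalIntegralLevel L 3 H v) ∧
          ((keys ξ v hns).1.2).IsSpherical (cmLocalIntegralLevel L 3 (qsForm L) v))) :
    (xiPacketFamilyOfRecordSCD L H hH hHd μω hμu μZ keys hSC ξ v).πn.IsSphericalWith (cmLocalIntegralLevel L 3 H v) (μv v) (xiEvpOfRecordSCD L H hH hHd μω hμu μZ keys hSC μv ξ v) ∧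
      (xiPacketFamilyOfRecordSCD L H hH hHd μω hμu μZ keys hSC ξ v).πn.IsAdmissible := by
  obtain ⟨hadm, hsph⟩ := isAdmissible_isSpherical_πn_of_goodSCD L H hH hHd μω hμu μZ keys hSC ξ v hgood
  exact ⟨IrrClass.IsSpherical.isSphericalWith_eigencharacter (μv v) hadm (isCompact_isOpen_cmLocalIntegralLevel L 3 H v).2
    (isCompact_isOpen_cmLocalIntegralLevel L 3 H v).1 (F0P3XiUnramSplitInstance.measureReal_cmLocalIntegralLevel_ne_zero L H v (μv v)) hsph, hadm⟩

/-- **LAW `XiUnram` AT 𝔠₀ IN EIGENCHARACTER CURRENCY**: with `ram₀ ξ := ramOfRecord₂ … ξ hexc`, for `v ∉ ram₀ ξ` and a Haar measure `μv v` on `G′_v`, the member `πⁿ`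
of record is `K_v`-spherical WITH `tXi₀ ξ v` and admissible — literally the `XiUnram` conjunct of the T5 line at (`packFin₀`, `ram₀`, `μv`, `tXi₀`).
[cite: Rogawski1990, §12.2 pp. 173–174; §13.1 p. 199; §13.7 p. 206] [cite: CartierCorvallis1979, §IV.1 Cor. 4.1] -/
theorem xiUnram_xiEvpOfRecordSCD (μv : ∀ v : HeightOneSpectrum (𝓞 ↥(maximalRealSubfield L)), Measure ((cmDatum L 3 H).Local v)) (ξ : OneDimAutRepH L)
    {hexc : ∀ᶠ v : HeightOneSpectrum (𝓞 ↥(maximalRealSubfield L)) in cofinite,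
      ∀ hns : ∀ w : PlacesOver L v, IsCMField.complexConj L • w.1 = w.1,
        ((keys ξ v hns).1.2).IsSpherical (cmLocalIntegralLevel L 3 (qsForm L) v)}
    (v : HeightOneSpectrum (𝓞 ↥(maximalRealSubfield L))) (hv : v ∉ ramOfRecord₂ L H hH hHd μω μZ keys ξ hexc)
    [BorelSpace ((cmDatum L 3 H).Local v)] [(μv v).IsHaarMeasure] :
    (xiPacketFamilyOfRecordSCD L H hH hHd μω hμu μZ keys hSC ξ v).πn.IsSphericalWith (cmLocalIntegralLevel L 3 H v) (μv v) (xiEvpOfRecordSCD L H hH hHd μω hμu μZ keys hSC μv ξ v) ∧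
      (xiPacketFamilyOfRecordSCD L H hH hHd μω hμu μZ keys hSC ξ v).πn.IsAdmissible :=
  xiUnram_xiEvpOfRecordSCD_of_good L H hH hHd μω hμu μZ keys hSC μv ξ v (good_of_not_mem_ramOfRecord₂ L H hH hHd μω μZ keys ξ hv)

/-- **LAW `XiUnram` AT 𝔠₀ FROM THE LETTERS OF RECORD, eigencharacter currency**: with `hexc₀ ξ := hexc_of_xiPinSphericalCofinite … hLi … ξ` ((L-i′) ★
`XiPinSphericalCofinite`) and `ram₀ ξ := ramOfRecord₂ … ξ (hexc₀ ξ)`, for `v ∉ ram₀ ξ` and Haar `μv v`: `πⁿ` of record is `K_v`-spherical WITH `tXi₀ ξ v` and admissible.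
[cite: Rogawski1990, §12.2 pp. 173–174; §13.1 p. 199; §13.7 pp. 206–208] [cite: CartierCorvallis1979, §IV.1 Cor. 4.1] -/
theorem xiUnram_xiEvpOfRecordSCD_of_xiPinSphericalCofinite
    [∀ v : HeightOneSpectrum (𝓞 ↥(maximalRealSubfield L)), BorelSpace (Gqs L v ⧸ Subgroup.center (Gqs L v))]
    [∀ v : HeightOneSpectrum (𝓞 ↥(maximalRealSubfield L)), (μZ v).IsHaarMeasure] (hLi : XiPinSphericalCofinite L) (μv : ∀ v : HeightOneSpectrum (𝓞 ↥(maximalRealSubfield L)), Measure ((cmDatum L 3 H).Local v))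
    (ξ : OneDimAutRepH L) (v : HeightOneSpectrum (𝓞 ↥(maximalRealSubfield L)))
    (hv : v ∉ ramOfRecord₂ L H hH hHd μω μZ keys ξ (hexc_of_xiPinSphericalCofinite L μω hμu μZ keys hquad hLi ξ))
    [BorelSpace ((cmDatum L 3 H).Local v)] [(μv v).IsHaarMeasure] :
    (xiPacketFamilyOfRecordSCD L H hH hHd μω hμu μZ keys hSC ξ v).πn.IsSphericalWith (cmLocalIntegralLevel L 3 H v) (μv v) (xiEvpOfRecordSCD L H hH hHd μω hμu μZ keys hSC μv ξ v) ∧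
      (xiPacketFamilyOfRecordSCD L H hH hHd μω hμu μZ keys hSC ξ v).πn.IsAdmissible :=
  xiUnram_xiEvpOfRecordSCD L H hH hHd μω hμu μZ keys hSC μv ξ v hv

/-- **NORMALISATION `tXi₀ ξ v (𝟙_{K_v}) = 1`** off `ram₀ ξ` for Haar `μv v` (★ `eigencharacter_indicator_eq_one`). [cite: CartierCorvallis1979, §IV.1 Cor. 4.1] -/
theorem xiEvpOfRecordSCD_indicator_eq_one (μv : ∀ v : HeightOneSpectrum (𝓞 ↥(maximalRealSubfield L)), Measure ((cmDatum L 3 H).Local v))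
    (ξ : OneDimAutRepH L)
    {hexc : ∀ᶠ v : HeightOneSpectrum (𝓞 ↥(maximalRealSubfield L)) in cofinite,
      ∀ hns : ∀ w : PlacesOver L v, IsCMField.complexConj L • w.1 = w.1,
        ((keys ξ v hns).1.2).IsSpherical (cmLocalIntegralLevel L 3 (qsForm L) v)}
    (v : HeightOneSpectrum (𝓞 ↥(maximalRealSubfield L))) (hv : v ∉ ramOfRecord₂ L H hH hHd μω μZ keys ξ hexc)
    [BorelSpace ((cmDatum L 3 H).Local v)] [(μv v).IsHaarMeasure] :
    xiEvpOfRecordSCD L H hH hHd μω hμu μZ keys hSC μv ξ v ((cmLocalIntegralLevel L 3 H v : Set ((cmDatum L 3 H).Local v)).indicator fun _ => (1 : ℂ)) = 1 := by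
  obtain ⟨hadm, hsph⟩ := isAdmissible_isSpherical_πn_of_goodSCD L H hH hHd μω hμu μZ keys hSC ξ v (good_of_not_mem_ramOfRecord₂ L H hH hHd μω μZ keys ξ hv)
  exact IrrClass.eigencharacter_indicator_eq_one (μv v) hadm (isCompact_isOpen_cmLocalIntegralLevel L 3 H v).2
    (isCompact_isOpen_cmLocalIntegralLevel L 3 H v).1 (F0P3XiUnramSplitInstance.measureReal_cmLocalIntegralLevel_ne_zero L H v (μv v)) hsph

/-- **UNRAMIFIED-MEMBER GLUE at a single place** (the mechanism of T5's `unramMember_of_pins`, stated for the record): off `ram₀ ξ`, for Haar `μv v`, ANY admissible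
class `c` that is `K_v`-spherical WITH the e.v.p. `tXi₀ ξ v` IS the member `πⁿ` of record (★ `IrrClass.eq_of_isSphericalWith`).
[cite: CartierCorvallis1979, §IV.1 Thm. 4.1, Cor. 4.1] [cite: Rogawski1990, §12.2 p. 174] -/
theorem eq_πn_of_isSphericalWith_xiEvpOfRecordSCD (μv : ∀ v : HeightOneSpectrum (𝓞 ↥(maximalRealSubfield L)), Measure ((cmDatum L 3 H).Local v))
    (ξ : OneDimAutRepH L)
    {hexc : ∀ᶠ v : HeightOneSpectrum (𝓞 ↥(maximalRealSubfield L)) in cofinite,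
      ∀ hns : ∀ w : PlacesOver L v, IsCMField.complexConj L • w.1 = w.1,
        ((keys ξ v hns).1.2).IsSpherical (cmLocalIntegralLevel L 3 (qsForm L) v)}
    (v : HeightOneSpectrum (𝓞 ↥(maximalRealSubfield L))) (hv : v ∉ ramOfRecord₂ L H hH hHd μω μZ keys ξ hexc)
    [BorelSpace ((cmDatum L 3 H).Local v)] [(μv v).IsHaarMeasure] {c : IrrClass ((cmDatum L 3 H).Local v)} (hadm : c.IsAdmissible)
    (hc : c.IsSphericalWith (cmLocalIntegralLevel L 3 H v) (μv v) (xiEvpOfRecordSCD L H hH hHd μω hμu μZ keys hSC μv ξ v)) :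
    c = (xiPacketFamilyOfRecordSCD L H hH hHd μω hμu μZ keys hSC ξ v).πn := by
  obtain ⟨hsw, hadm'⟩ := xiUnram_xiEvpOfRecordSCD L H hH hHd μω hμu μZ keys hSC μv ξ v hv
  exact IrrClass.eq_of_isSphericalWith (μv v) hadm hadm' (isCompact_isOpen_cmLocalIntegralLevel L 3 H v).2
    (isCompact_isOpen_cmLocalIntegralLevel L 3 H v).1 (F0P3XiUnramSplitInstance.measureReal_cmLocalIntegralLevel_ne_zero L H v (μv v)) hc hsw


end Evp

end Summit.HodgeConjecture.HodgeConjecture.Cruxes.H413.F0P3XiPacketFamilyOfRecordSCD
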